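import Literature.NumberTheory.GaloisRepresentations.CubicResidueSymbol

/-!
# The sextic residue symbol `(·/𝔭)₆` of `ℤ[ω]`

Source: K. Ireland, M. Rosen, *A Classical Introduction to Modern Number Theory* (GTM 84, Springer 1982),
Ch. 14 §2 "The power residue symbol": for a number field `K ⊇ μ_m`, a prime `𝔭 ∤ m` and `α ∉ 𝔭`,
`(α/𝔭)_m` is the unique `m`-th root of unity with `α^{(N𝔭−1)/m} ≡ (α/𝔭)_m (mod 𝔭)` (Prop. 14.2.1:
the `m`-th roots of unity are distinct mod `𝔭`, `m ∣ N𝔭 − 1`; Prop. 14.2.2: well-defined, multiplicative,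
`= 1` iff `α` is an `m`-th power mod `𝔭`), here at `m = 6` for `K = ℚ(ω)`, `𝓞 K = ℤ[ω]`, `μ₆ = {±1, ±ω, ±ω²}`
— the character `χ_π` of order `6` of Ch. 18 §7 (`y² = x³ + D`: `N_p = p + 1 + Σ (4D/π)₆ π̄ + …`), bib key
`IrelandRosen1982`; Cassels–Fröhlich, *Algebraic Number Theory*, Exercise 1 ("The power residue symbol").

This file is the `m = 6` twin of `CubicResidueSymbol.lean` (`m = 3`) and follows its design decisions
verbatim: the symbol is defined WITHOUT choosing a primitive root, as a function on the residue ring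
`𝓞 K ⧸ 𝔭` with values in `𝓞 K`,

  `sexticResidueSymbol 𝔭 a = Σ_{μ ∈ 𝓞 K, μ⁶ = 1} (if μ ≡ a^{(N𝔭−1)/6} (mod 𝔭) then μ else 0)`,

and the API takes a primitive sixth root of unity `hζ : IsPrimitiveRoot ζ 6` in `𝓞 K` as an explicit
hypothesis (for `ℚ(ω)`: `ζ = −ω`, `exists_isPrimitiveRoot_six`). The good primes are those with
`2 ∉ 𝔭` and `3 ∉ 𝔭` (`𝔭 ∤ 6`); no junk-value analysis at `𝔭 ∣ 6` is attempted (all statements there are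
conditional on `2, 3 ∉ 𝔭`).

## Contents
* `sexticResidueSymbol`; `isPrimitiveRoot_neg_of_isPrimitiveRoot_three` (`−ω` is a primitive sixth root),
  `exists_isPrimitiveRoot_six` (in `ℚ(ω)`), `pow_three_eq_neg_one` (`ζ³ = −1`);
* `isPrimitiveRoot_mk_of_two_three_not_mem` (the reduction of `ζ` mod `𝔭 ∤ 6` has order `6`),
  `six_dvd_residueCard_sub_one` (`6 ∣ N𝔭 − 1`), `nthRootsFinset_six_eq_image`,
  `sexticResidueSymbol_eq_sum_range` (independence of `ζ`);
* Ireland–Rosen's characterisation `sexticResidueSymbol_spec` / `sexticResidueSymbol_eq_iff`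
  (for `𝔭 ∤ 6`, `a ≠ 0`: `χ₆(a)` is THE sixth root of unity `≡ a^{(N𝔭−1)/6}`), `sexticResidueSymbol_zero`,
  `sexticResidueSymbol_one`, `sexticResidueSymbol_mul`, `sexticResidueSymbol_eq_zero_or_pow_six`,
  `sexticResidueSymbol_mem` (values `0` or `ζ^i`, `i < 6`);
* the bridges to the lower symbols: ★ `sexticResidueSymbol_sq` — `χ₆(a)² = χ₃(a)` (the tree's
  `cubicResidueSymbol`), and `mk_sexticResidueSymbol_pow_three` — `χ₆(a)³ ≡ a^{(N𝔭−1)/2}` (Euler's criterion: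
  `χ₆³` is the quadratic character), `sexticResidueSymbol_pow_three_sq` (`(χ₆(a)³)² = 1`);
* `sexticResidueChar hζ 𝔭 h2 h3 : MulChar (𝓞 K ⧸ 𝔭) (𝓞 K)` with `sexticResidueChar_pow_six`.

For the BED route (`Summits/BirchSwinnertonDyer`, crux `ManinDatumSupercuspidalCMInert`, stub `S5`): at the
inert prime `𝔭 = (5)` of `ℤ[ω]` (`N𝔭 = 25`) the spec reads `(c/5)₆ ≡ c⁴ (mod 5)` — the weight of the
`5`-torsion sums of the `j = 0` cell (memo KIT-RES-CERT-w1g8 §5, item D1). Nothing about elliptic curves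
or BSD is proved here.

## Not here
Sextic / cubic reciprocity and the supplement for `1 − ω` and rational primes (Ireland–Rosen Ch. 9 §§4–6,
Thm. 14.3.1), Jacobi sums and the point count of `y² = x³ + D` (Ch. 18 §3–§7).
-/

namespace Literature.NumberTheory.GaloisRepresentations

open NumberField IsDedekindDomain Polynomial

variable {K : Type*} [Field K] [NumberField K]

/-- The **sextic residue symbol** `χ_𝔭 = (·/𝔭)₆` at a finite place `𝔭` of a number field `K`
(intended for `K = ℚ(ω)`, `𝓞 K = ℤ[ω] ∋ ±1, ±ω, ±ω²`), as a function on `𝓞 K ⧸ 𝔭` with values in `𝓞 K`: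
`χ_𝔭(a) = Σ_{μ ∈ 𝓞 K, μ⁶ = 1} (if μ ≡ a^{(N𝔭−1)/6} (mod 𝔭) then μ else 0)`, `N𝔭 = #(𝓞 K ⧸ 𝔭)`.
For `𝔭 ∤ 6` the sixth roots of unity are pairwise incongruent mod `𝔭`, `6 ∣ N𝔭 − 1`, and for `a ≠ 0`
exactly one of them is `≡ a^{(N𝔭−1)/6}`, so `χ_𝔭(a)` is the unique sixth root of unity congruent to
`a^{(N𝔭−1)/6}` modulo `𝔭`, while `χ_𝔭(0) = 0`; see `sexticResidueSymbol_eq_iff`, `sexticResidueSymbol_zero`.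
[cite: IrelandRosen1982, Ch. 14 §2, Definition before Prop. 14.2.1] -/
noncomputable def sexticResidueSymbol (𝔭 : HeightOneSpectrum (𝓞 K)) (a : 𝓞 K ⧸ 𝔭.asIdeal) : 𝓞 K :=
  haveI := Classical.decEq (𝓞 K ⧸ 𝔭.asIdeal)
  ∑ μ ∈ nthRootsFinset 6 (1 : 𝓞 K),
    if Ideal.Quotient.mk 𝔭.asIdeal μ = a ^ ((𝔭.residueCard - 1) / 6) then μ else 0

/-! ### Primitive sixth roots of unity in `𝓞 K` -/

/-- If `ω` is a primitive cube root of unity in `𝓞 K` then `−ω` is a primitive sixth root of unity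
(`𝓞 K` has characteristic `0`, so `−1 ≠ 1`): the units `±1, ±ω, ±ω²` of `ℤ[ω]` are the sixth roots of unity.
[cite: IrelandRosen1982, Ch. 9 §1, Prop. 9.1.1] -/
theorem isPrimitiveRoot_neg_of_isPrimitiveRoot_three {ω : 𝓞 K} (hω : IsPrimitiveRoot ω 3) :
    IsPrimitiveRoot (-ω) 6 := by
  have h3 : ω ^ 3 = 1 := hω.pow_eq_one
  have h1 : ω ≠ 1 := hω.ne_one (by norm_num)
  have h2 : ω ^ 2 ≠ 1 := hω.pow_ne_one_of_pos_of_lt (by norm_num) (by norm_num)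
  have hm1 : (-1 : 𝓞 K) ≠ 1 := fun h ↦ by
    have h2' : (2 : 𝓞 K) = 0 := by linear_combination -h
    exact two_ne_zero h2'
  refine (IsPrimitiveRoot.iff (by norm_num)).mpr ⟨by linear_combination (ω ^ 3 + 1) * h3, ?_⟩
  intro l hl0 hl6
  interval_cases l
  · -- `l = 1`: `−ω = 1 ⇒ ω² = 1`
    intro h
    exact h2 (by linear_combination (1 - ω) * h)
  · intro h
    exact h2 (by linear_combination h)
  · intro h
    exact hm1 (by linear_combination h + h3)
  · intro h
    exact h1 (by linear_combination h - ω * h3)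
  · intro h
    -- `−ω⁵ = 1 ⇒ ω² = −1 ⇒ ω⁴ = 1 ⇒ ω = 1`
    exact h1 (by linear_combination (1 - ω ^ 2) * h - (ω ^ 4 - ω ^ 2 + ω) * h3)

/-- `ℚ(ω)` (indeed any `K` that is a `3`-rd cyclotomic extension of `ℚ`) contains a primitive sixth root
of unity in its ring of integers (`−ω`). [cite: IrelandRosen1982, Ch. 9 §1, Prop. 9.1.1] -/
theorem exists_isPrimitiveRoot_six [IsCyclotomicExtension {3} ℚ K] :
    ∃ ζ : 𝓞 K, IsPrimitiveRoot ζ 6 := by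
  obtain ⟨ω, hω⟩ := exists_isPrimitiveRoot_three (K := K)
  exact ⟨-ω, isPrimitiveRoot_neg_of_isPrimitiveRoot_three hω⟩

variable {ζ : 𝓞 K} (hζ : IsPrimitiveRoot ζ 6)
include hζ

omit [NumberField K] in
/-- `ζ³ = −1` for a primitive sixth root of unity (`(ζ³)² = 1`, `ζ³ ≠ 1`, `𝓞 K` a domain).
[cite: IrelandRosen1982, Ch. 9 §1, Prop. 9.1.1] -/
theorem pow_three_eq_neg_one : ζ ^ 3 = -1 := by
  have h6 : ζ ^ 3 * ζ ^ 3 = 1 := by rw [← pow_add]; exact hζ.pow_eq_one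
  have hne : ζ ^ 3 ≠ 1 := hζ.pow_ne_one_of_pos_of_lt (by norm_num) (by norm_num)
  rcases mul_self_eq_one_iff.mp h6 with h | h
  · exact absurd h hne
  · exact h

omit [NumberField K] in
/-- `ζ²` is a primitive cube root of unity (`ζ = −ω ⇒ ζ² = ω²`). [cite: IrelandRosen1982, Ch. 9 §1, Prop. 9.1.1] -/
theorem isPrimitiveRoot_sq_three : IsPrimitiveRoot (ζ ^ 2) 3 :=
  hζ.pow (by norm_num) (by norm_num)

omit [NumberField K] in
/-- The sixth roots of unity of `𝓞 K` are `ζ^j`, `j < 6` (`𝓞 K` is a domain). [cite: IrelandRosen1982, Ch. 9 §1, Prop. 9.1.1] -/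
theorem nthRootsFinset_six_eq_image [DecidableEq (𝓞 K)] :
    nthRootsFinset 6 (1 : 𝓞 K) = (Finset.range 6).image (ζ ^ ·) := by
  rw [nthRootsFinset_def, hζ.nthRoots_eq (one_pow 6), Multiset.toFinset_map, ← Finset.range_val,
    Finset.val_toFinset]
  simp only [mul_one]

/-- **Independence of the choice of `ζ`, expanded form.** For any primitive sixth root of unity `ζ ∈ 𝓞 K`,
`χ_𝔭(a) = Σ_{j < 6} (if ζ^j ≡ a^{(N𝔭−1)/6} (mod 𝔭) then ζ^j else 0)`.
[cite: IrelandRosen1982, Ch. 14 §2, Definition before Prop. 14.2.1] -/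
theorem sexticResidueSymbol_eq_sum_range (𝔭 : HeightOneSpectrum (𝓞 K)) (a : 𝓞 K ⧸ 𝔭.asIdeal)
    [∀ j : ℕ, Decidable (Ideal.Quotient.mk 𝔭.asIdeal (ζ ^ j) = a ^ ((𝔭.residueCard - 1) / 6))] :
    sexticResidueSymbol 𝔭 a = ∑ j ∈ Finset.range 6,
      (if Ideal.Quotient.mk 𝔭.asIdeal (ζ ^ j) = a ^ ((𝔭.residueCard - 1) / 6) then ζ ^ j else 0) := by
  classical
  unfold sexticResidueSymbol
  rw [nthRootsFinset_six_eq_image hζ, Finset.sum_image fun i hi j hj h =>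
    hζ.pow_inj (Finset.mem_range.1 hi) (Finset.mem_range.1 hj) h]
  refine Finset.sum_congr rfl fun j _ => ?_
  split_ifs <;> rfl

/-! ### The good primes `𝔭 ∤ 6` -/

omit [NumberField K] in
/-- For `2, 3 ∉ 𝔭` the reduction of `ζ` is a primitive SIXTH root of unity of the residue ring
(`ζ² ↦` a primitive cube root since `3 ∉ 𝔭`; `ζ³ = −1 ↦ −1 ≠ 1` since `2 ∉ 𝔭`) — Ireland–Rosen's
"the `m`-th roots of unity are distinct mod `𝔭` for `𝔭 ∤ m`". [cite: IrelandRosen1982, Ch. 14 §2, Prop. 14.2.1] -/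
theorem isPrimitiveRoot_mk_of_two_three_not_mem {𝔭 : HeightOneSpectrum (𝓞 K)}
    (h2 : (2 : 𝓞 K) ∉ 𝔭.asIdeal) (h3 : (3 : 𝓞 K) ∉ 𝔭.asIdeal) :
    IsPrimitiveRoot (Ideal.Quotient.mk 𝔭.asIdeal ζ) 6 := by
  have h6 : Ideal.Quotient.mk 𝔭.asIdeal ζ ^ 6 = 1 := by rw [← map_pow, hζ.pow_eq_one, map_one]
  have hm3 : Ideal.Quotient.mk 𝔭.asIdeal ζ ^ 2 ≠ 1 := fun h ↦
    h3 ((mk_eq_one_iff_three_mem (isPrimitiveRoot_sq_three hζ) 𝔭).mp (by rw [map_pow]; exact h))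
  have hm2 : Ideal.Quotient.mk 𝔭.asIdeal ζ ^ 3 ≠ 1 := by
    rw [← map_pow, pow_three_eq_neg_one hζ, map_neg, map_one]
    intro h
    apply h2
    rw [← Ideal.Quotient.eq_zero_iff_mem, map_ofNat]
    linear_combination -h
  refine (IsPrimitiveRoot.iff (by norm_num)).mpr ⟨h6, ?_⟩
  intro l hl0 hl6
  interval_cases l
  · intro h
    rw [pow_one] at h
    exact hm3 (by rw [h, one_pow])
  · exact hm3
  · exact hm2
  · intro h
    apply hm3
    calc Ideal.Quotient.mk 𝔭.asIdeal ζ ^ 2 = Ideal.Quotient.mk 𝔭.asIdeal ζ ^ 4 * Ideal.Quotient.mk 𝔭.asIdeal ζ ^ 2 := by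
          rw [h, one_mul]
      _ = Ideal.Quotient.mk 𝔭.asIdeal ζ ^ 6 := by ring
      _ = 1 := h6
  · intro h
    apply hm3
    have h1 : Ideal.Quotient.mk 𝔭.asIdeal ζ = 1 := by
      calc Ideal.Quotient.mk 𝔭.asIdeal ζ = Ideal.Quotient.mk 𝔭.asIdeal ζ ^ 5 * Ideal.Quotient.mk 𝔭.asIdeal ζ := by
            rw [h, one_mul]
        _ = Ideal.Quotient.mk 𝔭.asIdeal ζ ^ 6 := by ring
        _ = 1 := h6
    rw [h1, one_pow]

/-- `6 ∣ N𝔭 − 1` for `𝔭 ∤ 6` (`μ₆` is a subgroup of order `6` of `(𝓞 K ⧸ 𝔭)ˣ`).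
[cite: IrelandRosen1982, Ch. 14 §2, Prop. 14.2.1] -/
theorem six_dvd_residueCard_sub_one {𝔭 : HeightOneSpectrum (𝓞 K)}
    (h2 : (2 : 𝓞 K) ∉ 𝔭.asIdeal) (h3 : (3 : 𝓞 K) ∉ 𝔭.asIdeal) : 6 ∣ 𝔭.residueCard - 1 := by
  letI := Ideal.Quotient.field 𝔭.asIdeal
  have hprim0 := isPrimitiveRoot_mk_of_two_three_not_mem hζ h2 h3
  have hu := hprim0.isUnit (by norm_num)
  have hprim : IsPrimitiveRoot hu.unit 6 :=
    IsPrimitiveRoot.coe_units_iff.1 (by simpa only [IsUnit.unit_spec] using hprim0)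
  have h := orderOf_dvd_natCard hu.unit
  rwa [← hprim.eq_orderOf, Nat.card_units, ← HeightOneSpectrum.residueCard_eq_card_quotient] at h

/-- For `𝔭 ∤ 6` the exponent `(N𝔭 − 1)/6` is nonzero (`6 ∣ N𝔭 − 1`, `N𝔭 > 1`). [cite: IrelandRosen1982, Ch. 14 §2, Prop. 14.2.1] -/
theorem residueCard_sub_one_div_six_ne_zero {𝔭 : HeightOneSpectrum (𝓞 K)}
    (h2 : (2 : 𝓞 K) ∉ 𝔭.asIdeal) (h3 : (3 : 𝓞 K) ∉ 𝔭.asIdeal) : (𝔭.residueCard - 1) / 6 ≠ 0 := by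
  have h1 := 𝔭.one_lt_residueCard
  have h := Nat.le_of_dvd (by omega) (six_dvd_residueCard_sub_one hζ h2 h3)
  exact (Nat.div_pos h (by norm_num)).ne'

/-- Fermat in the residue field, sixth-power form: for `𝔭 ∤ 6` and `a ≢ 0`, `(a^{(N𝔭−1)/6})⁶ = a^{N𝔭−1} = 1`.
[cite: IrelandRosen1982, Ch. 14 §2, proof of Prop. 14.2.1] -/
theorem pow_residueCard_sub_one_div_six_pow_six {𝔭 : HeightOneSpectrum (𝓞 K)}
    (h2 : (2 : 𝓞 K) ∉ 𝔭.asIdeal) (h3 : (3 : 𝓞 K) ∉ 𝔭.asIdeal) {a : 𝓞 K ⧸ 𝔭.asIdeal} (ha : a ≠ 0) :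
    (a ^ ((𝔭.residueCard - 1) / 6)) ^ 6 = 1 := by
  letI := Ideal.Quotient.field 𝔭.asIdeal
  letI := Fintype.ofFinite (𝓞 K ⧸ 𝔭.asIdeal)
  rw [← pow_mul, Nat.div_mul_cancel (six_dvd_residueCard_sub_one hζ h2 h3),
    HeightOneSpectrum.residueCard_eq_card_quotient, Nat.card_eq_fintype_card]
  exact FiniteField.pow_card_sub_one_eq_one a ha

/-- Existence (Ireland–Rosen Prop. 14.2.1): for `𝔭 ∤ 6`, `a ≢ 0` there is `i < 6` with
`a^{(N𝔭−1)/6} ≡ ζ^i (mod 𝔭)`. [cite: IrelandRosen1982, Ch. 14 §2, Prop. 14.2.1] -/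
theorem exists_mk_pow_eq_pow_residueCard_sub_one_div_six {𝔭 : HeightOneSpectrum (𝓞 K)}
    (h2 : (2 : 𝓞 K) ∉ 𝔭.asIdeal) (h3 : (3 : 𝓞 K) ∉ 𝔭.asIdeal) {a : 𝓞 K ⧸ 𝔭.asIdeal} (ha : a ≠ 0) :
    ∃ i < 6, Ideal.Quotient.mk 𝔭.asIdeal (ζ ^ i) = a ^ ((𝔭.residueCard - 1) / 6) := by
  obtain ⟨i, hi, h⟩ := (isPrimitiveRoot_mk_of_two_three_not_mem hζ h2 h3).eq_pow_of_pow_eq_one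
    (pow_residueCard_sub_one_div_six_pow_six hζ h2 h3 ha)
  exact ⟨i, hi, by rwa [map_pow]⟩

/-- Evaluation: if `ζ^i ≡ a^{(N𝔭−1)/6} (mod 𝔭)` (`𝔭 ∤ 6`, `i < 6`) then `χ_𝔭(a) = ζ^i` — the other summands
vanish because the `ζ^j`, `j < 6`, are distinct mod `𝔭`. [cite: IrelandRosen1982, Ch. 14 §2, Prop. 14.2.1] -/
theorem sexticResidueSymbol_eq_pow_of_mk_pow_eq {𝔭 : HeightOneSpectrum (𝓞 K)}
    (h2 : (2 : 𝓞 K) ∉ 𝔭.asIdeal) (h3 : (3 : 𝓞 K) ∉ 𝔭.asIdeal) {a : 𝓞 K ⧸ 𝔭.asIdeal} {i : ℕ} (hi : i < 6)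
    (h : Ideal.Quotient.mk 𝔭.asIdeal (ζ ^ i) = a ^ ((𝔭.residueCard - 1) / 6)) :
    sexticResidueSymbol 𝔭 a = ζ ^ i := by
  classical
  rw [sexticResidueSymbol_eq_sum_range hζ, Finset.sum_eq_single i, if_pos h]
  · intro j hj hji
    rw [if_neg]
    intro hj'
    refine hji ((isPrimitiveRoot_mk_of_two_three_not_mem hζ h2 h3).pow_inj (Finset.mem_range.1 hj) hi ?_)
    rw [← map_pow, ← map_pow, hj', h]
  · intro hi'
    exact absurd (Finset.mem_range.2 hi) hi'

/-- Uniqueness form of the definition: for `𝔭 ∤ 6`, a sixth root of unity `μ` with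
`μ ≡ a^{(N𝔭−1)/6} (mod 𝔭)` IS `χ_𝔭(a)`. [cite: IrelandRosen1982, Ch. 14 §2, Prop. 14.2.1] -/
theorem sexticResidueSymbol_eq_of_pow_six_eq_one {𝔭 : HeightOneSpectrum (𝓞 K)}
    (h2 : (2 : 𝓞 K) ∉ 𝔭.asIdeal) (h3 : (3 : 𝓞 K) ∉ 𝔭.asIdeal) {a : 𝓞 K ⧸ 𝔭.asIdeal} {μ : 𝓞 K} (hμ : μ ^ 6 = 1)
    (h : Ideal.Quotient.mk 𝔭.asIdeal μ = a ^ ((𝔭.residueCard - 1) / 6)) :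
    sexticResidueSymbol 𝔭 a = μ := by
  obtain ⟨i, hi, rfl⟩ := hζ.eq_pow_of_pow_eq_one hμ
  exact sexticResidueSymbol_eq_pow_of_mk_pow_eq hζ h2 h3 hi h

/-- For `𝔭 ∤ 6` and `a ≢ 0`: `χ_𝔭(a)⁶ = 1` and `χ_𝔭(a) ≡ a^{(N𝔭−1)/6} (mod 𝔭)`.
[cite: IrelandRosen1982, Ch. 14 §2, Prop. 14.2.2] -/
theorem sexticResidueSymbol_spec {𝔭 : HeightOneSpectrum (𝓞 K)}
    (h2 : (2 : 𝓞 K) ∉ 𝔭.asIdeal) (h3 : (3 : 𝓞 K) ∉ 𝔭.asIdeal) {a : 𝓞 K ⧸ 𝔭.asIdeal} (ha : a ≠ 0) :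
    sexticResidueSymbol 𝔭 a ^ 6 = 1 ∧
      Ideal.Quotient.mk 𝔭.asIdeal (sexticResidueSymbol 𝔭 a) = a ^ ((𝔭.residueCard - 1) / 6) := by
  obtain ⟨i, hi, h⟩ := exists_mk_pow_eq_pow_residueCard_sub_one_div_six hζ h2 h3 ha
  rw [sexticResidueSymbol_eq_pow_of_mk_pow_eq hζ h2 h3 hi h]
  exact ⟨by rw [← pow_mul, mul_comm, pow_mul, hζ.pow_eq_one, one_pow], h⟩

/-- **Ireland–Rosen's definition as a characterisation.** For `𝔭 ∤ 6` and `a ≢ 0 (mod 𝔭)`,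
`χ_𝔭(a) = μ` iff `μ` is a sixth root of unity with `μ ≡ a^{(N𝔭−1)/6} (mod 𝔭)`.
[cite: IrelandRosen1982, Ch. 14 §2, Definition before Prop. 14.2.1] -/
theorem sexticResidueSymbol_eq_iff {𝔭 : HeightOneSpectrum (𝓞 K)}
    (h2 : (2 : 𝓞 K) ∉ 𝔭.asIdeal) (h3 : (3 : 𝓞 K) ∉ 𝔭.asIdeal) {a : 𝓞 K ⧸ 𝔭.asIdeal} (ha : a ≠ 0) {μ : 𝓞 K} :
    sexticResidueSymbol 𝔭 a = μ ↔
      μ ^ 6 = 1 ∧ Ideal.Quotient.mk 𝔭.asIdeal μ = a ^ ((𝔭.residueCard - 1) / 6) :=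
  ⟨fun h => h ▸ sexticResidueSymbol_spec hζ h2 h3 ha,
    fun h => sexticResidueSymbol_eq_of_pow_six_eq_one hζ h2 h3 h.1 h.2⟩

/-- `χ_𝔭(0) = 0` for `𝔭 ∤ 6`: `0^{(N𝔭−1)/6} = 0` is not congruent to a unit.
[cite: IrelandRosen1982, Ch. 14 §2, Definition before Prop. 14.2.1] -/
theorem sexticResidueSymbol_zero {𝔭 : HeightOneSpectrum (𝓞 K)}
    (h2 : (2 : 𝓞 K) ∉ 𝔭.asIdeal) (h3 : (3 : 𝓞 K) ∉ 𝔭.asIdeal) : sexticResidueSymbol 𝔭 0 = 0 := by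
  classical
  rw [sexticResidueSymbol_eq_sum_range hζ]
  refine Finset.sum_eq_zero fun j _ => if_neg ?_
  rw [zero_pow (residueCard_sub_one_div_six_ne_zero hζ h2 h3), map_pow]
  exact pow_ne_zero _ ((isPrimitiveRoot_mk_of_two_three_not_mem hζ h2 h3).ne_zero (by norm_num))

/-- `χ_𝔭(1) = 1` for `𝔭 ∤ 6`. [cite: IrelandRosen1982, Ch. 14 §2, Prop. 14.2.2] -/
theorem sexticResidueSymbol_one {𝔭 : HeightOneSpectrum (𝓞 K)}
    (h2 : (2 : 𝓞 K) ∉ 𝔭.asIdeal) (h3 : (3 : 𝓞 K) ∉ 𝔭.asIdeal) : sexticResidueSymbol 𝔭 1 = 1 :=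
  sexticResidueSymbol_eq_of_pow_six_eq_one hζ h2 h3 (one_pow 6) (by rw [map_one, one_pow])

/-- **Multiplicativity** `χ_𝔭(ab) = χ_𝔭(a) χ_𝔭(b)` for `𝔭 ∤ 6`. [cite: IrelandRosen1982, Ch. 14 §2, Prop. 14.2.2 (b)] -/
theorem sexticResidueSymbol_mul {𝔭 : HeightOneSpectrum (𝓞 K)}
    (h2 : (2 : 𝓞 K) ∉ 𝔭.asIdeal) (h3 : (3 : 𝓞 K) ∉ 𝔭.asIdeal) (a b : 𝓞 K ⧸ 𝔭.asIdeal) :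
    sexticResidueSymbol 𝔭 (a * b) = sexticResidueSymbol 𝔭 a * sexticResidueSymbol 𝔭 b := by
  rcases eq_or_ne a 0 with rfl | ha
  · rw [zero_mul, sexticResidueSymbol_zero hζ h2 h3, zero_mul]
  rcases eq_or_ne b 0 with rfl | hb
  · rw [mul_zero, sexticResidueSymbol_zero hζ h2 h3, mul_zero]
  obtain ⟨ha6, ham⟩ := sexticResidueSymbol_spec hζ h2 h3 ha
  obtain ⟨hb6, hbm⟩ := sexticResidueSymbol_spec hζ h2 h3 hb
  exact sexticResidueSymbol_eq_of_pow_six_eq_one hζ h2 h3 (by rw [mul_pow, ha6, hb6, one_mul])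
    (by rw [map_mul, ham, hbm, mul_pow])

/-- `χ_𝔭(a)` is `0` or a sixth root of unity (`𝔭 ∤ 6`). [cite: IrelandRosen1982, Ch. 14 §2, Prop. 14.2.2] -/
theorem sexticResidueSymbol_eq_zero_or_pow_six {𝔭 : HeightOneSpectrum (𝓞 K)}
    (h2 : (2 : 𝓞 K) ∉ 𝔭.asIdeal) (h3 : (3 : 𝓞 K) ∉ 𝔭.asIdeal) (a : 𝓞 K ⧸ 𝔭.asIdeal) :
    sexticResidueSymbol 𝔭 a = 0 ∨ sexticResidueSymbol 𝔭 a ^ 6 = 1 := by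
  rcases eq_or_ne a 0 with rfl | ha
  · exact Or.inl (sexticResidueSymbol_zero hζ h2 h3)
  · exact Or.inr (sexticResidueSymbol_spec hζ h2 h3 ha).1

/-- The values of `χ_𝔭` (`𝔭 ∤ 6`) are `0` and the powers `ζ^i`, `i < 6`. [cite: IrelandRosen1982, Ch. 14 §2, Prop. 14.2.2] -/
theorem sexticResidueSymbol_mem {𝔭 : HeightOneSpectrum (𝓞 K)}
    (h2 : (2 : 𝓞 K) ∉ 𝔭.asIdeal) (h3 : (3 : 𝓞 K) ∉ 𝔭.asIdeal) (a : 𝓞 K ⧸ 𝔭.asIdeal) :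
    sexticResidueSymbol 𝔭 a = 0 ∨ ∃ i < 6, sexticResidueSymbol 𝔭 a = ζ ^ i := by
  rcases eq_or_ne a 0 with rfl | ha
  · exact Or.inl (sexticResidueSymbol_zero hζ h2 h3)
  obtain ⟨i, hi, h⟩ := exists_mk_pow_eq_pow_residueCard_sub_one_div_six hζ h2 h3 ha
  exact Or.inr ⟨i, hi, sexticResidueSymbol_eq_pow_of_mk_pow_eq hζ h2 h3 hi h⟩

/-- `χ_𝔭(a) ≠ 0` for `𝔭 ∤ 6` and `a ≢ 0` (it is a root of unity). [cite: IrelandRosen1982, Ch. 14 §2, Prop. 14.2.2] -/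
theorem sexticResidueSymbol_ne_zero {𝔭 : HeightOneSpectrum (𝓞 K)}
    (h2 : (2 : 𝓞 K) ∉ 𝔭.asIdeal) (h3 : (3 : 𝓞 K) ∉ 𝔭.asIdeal) {a : 𝓞 K ⧸ 𝔭.asIdeal} (ha : a ≠ 0) :
    sexticResidueSymbol 𝔭 a ≠ 0 := by
  intro h0
  have h1 := (sexticResidueSymbol_spec hζ h2 h3 ha).1
  rw [h0] at h1
  norm_num at h1

/-! ### The cubic and quadratic shadows: `χ₆² = χ₃`, `χ₆³ = ` Euler's quadratic character -/

/-- For `𝔭 ∤ 6`: `(N𝔭 − 1)/6 · 2 = (N𝔭 − 1)/3` and `(N𝔭 − 1)/6 · 3 = (N𝔭 − 1)/2` (exact divisions, `6 ∣ N𝔭 − 1`).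
[cite: IrelandRosen1982, Ch. 14 §2, Prop. 14.2.1] -/
theorem residueCard_sub_one_div_six_mul {𝔭 : HeightOneSpectrum (𝓞 K)}
    (h2 : (2 : 𝓞 K) ∉ 𝔭.asIdeal) (h3 : (3 : 𝓞 K) ∉ 𝔭.asIdeal) :
    (𝔭.residueCard - 1) / 6 * 2 = (𝔭.residueCard - 1) / 3 ∧
      (𝔭.residueCard - 1) / 6 * 3 = (𝔭.residueCard - 1) / 2 := by
  obtain ⟨m, hm⟩ := six_dvd_residueCard_sub_one hζ h2 h3
  constructor <;> omega

/-- ★ **`χ₆(a)² = χ₃(a)`**: the square of the sextic residue symbol is the tree's cubic residue symbol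
(`𝔭 ∤ 6`; both vanish at `a = 0`): `χ₆(a)²` is a cube root of unity `≡ a^{2(N𝔭−1)/6} = a^{(N𝔭−1)/3}`.
[cite: IrelandRosen1982, Ch. 14 §2, Prop. 14.2.2] -/
theorem sexticResidueSymbol_sq {𝔭 : HeightOneSpectrum (𝓞 K)}
    (h2 : (2 : 𝓞 K) ∉ 𝔭.asIdeal) (h3 : (3 : 𝓞 K) ∉ 𝔭.asIdeal) (a : 𝓞 K ⧸ 𝔭.asIdeal) :
    sexticResidueSymbol 𝔭 a ^ 2 = cubicResidueSymbol 𝔭 a := by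
  have hζ3 := isPrimitiveRoot_sq_three hζ
  rcases eq_or_ne a 0 with rfl | ha
  · rw [sexticResidueSymbol_zero hζ h2 h3, cubicResidueSymbol_zero hζ3, zero_pow two_ne_zero]
  obtain ⟨h6, hm⟩ := sexticResidueSymbol_spec hζ h2 h3 ha
  symm
  refine cubicResidueSymbol_eq_of_pow_three_eq_one hζ3 h3 (by rw [← pow_mul]; exact h6) ?_
  rw [map_pow, hm, ← pow_mul, (residueCard_sub_one_div_six_mul hζ h2 h3).1]

/-- **`χ₆(a)³ ≡ a^{(N𝔭−1)/2} (mod 𝔭)`** (`𝔭 ∤ 6`, `a ≢ 0`): the cube of the sextic symbol is Euler's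
quadratic character. [cite: IrelandRosen1982, Ch. 14 §2, Prop. 14.2.2] -/
theorem mk_sexticResidueSymbol_pow_three {𝔭 : HeightOneSpectrum (𝓞 K)}
    (h2 : (2 : 𝓞 K) ∉ 𝔭.asIdeal) (h3 : (3 : 𝓞 K) ∉ 𝔭.asIdeal) {a : 𝓞 K ⧸ 𝔭.asIdeal} (ha : a ≠ 0) :
    Ideal.Quotient.mk 𝔭.asIdeal (sexticResidueSymbol 𝔭 a ^ 3) = a ^ ((𝔭.residueCard - 1) / 2) := by
  obtain ⟨-, hm⟩ := sexticResidueSymbol_spec hζ h2 h3 ha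
  rw [map_pow, hm, ← pow_mul, (residueCard_sub_one_div_six_mul hζ h2 h3).2]

/-- `(χ₆(a)³)² = 1` for `𝔭 ∤ 6`, `a ≢ 0` (so `χ₆(a)³ = ±1`: the quadratic residue symbol). [cite: IrelandRosen1982, Ch. 14 §2, Prop. 14.2.2] -/
theorem sexticResidueSymbol_pow_three_sq {𝔭 : HeightOneSpectrum (𝓞 K)}
    (h2 : (2 : 𝓞 K) ∉ 𝔭.asIdeal) (h3 : (3 : 𝓞 K) ∉ 𝔭.asIdeal) {a : 𝓞 K ⧸ 𝔭.asIdeal} (ha : a ≠ 0) :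
    (sexticResidueSymbol 𝔭 a ^ 3) ^ 2 = 1 := by
  rw [← pow_mul]
  exact (sexticResidueSymbol_spec hζ h2 h3 ha).1

/-- `χ₆(a)³ = 1 ∨ χ₆(a)³ = −1` for `𝔭 ∤ 6`, `a ≢ 0`. [cite: IrelandRosen1982, Ch. 14 §2, Prop. 14.2.2] -/
theorem sexticResidueSymbol_pow_three_eq_one_or {𝔭 : HeightOneSpectrum (𝓞 K)}
    (h2 : (2 : 𝓞 K) ∉ 𝔭.asIdeal) (h3 : (3 : 𝓞 K) ∉ 𝔭.asIdeal) {a : 𝓞 K ⧸ 𝔭.asIdeal} (ha : a ≠ 0) :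
    sexticResidueSymbol 𝔭 a ^ 3 = 1 ∨ sexticResidueSymbol 𝔭 a ^ 3 = -1 :=
  mul_self_eq_one_iff.mp (by rw [← sq]; exact sexticResidueSymbol_pow_three_sq hζ h2 h3 ha)

/-! ### The sextic residue character -/

/-- For `𝔭 ∤ 6`, the sextic residue symbol as a **multiplicative character** of the residue field
`𝓞 K ⧸ 𝔭` with values in `𝓞 K = ℤ[ω]` (Ireland–Rosen, Ch. 14 §2). The witness `hζ` only certifies that
`𝓞 K` contains the sixth roots of unity; the character does not depend on it (`sexticResidueChar_apply`).
[cite: IrelandRosen1982, Ch. 14 §2, Prop. 14.2.2] -/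
noncomputable def sexticResidueChar (𝔭 : HeightOneSpectrum (𝓞 K))
    (h2 : (2 : 𝓞 K) ∉ 𝔭.asIdeal) (h3 : (3 : 𝓞 K) ∉ 𝔭.asIdeal) :
    MulChar (𝓞 K ⧸ 𝔭.asIdeal) (𝓞 K) where
  toFun := sexticResidueSymbol 𝔭
  map_one' := sexticResidueSymbol_one hζ h2 h3
  map_mul' := sexticResidueSymbol_mul hζ h2 h3
  map_nonunit' a ha := by
    letI := Ideal.Quotient.field 𝔭.asIdeal
    rw [isUnit_iff_ne_zero, ne_eq, not_not] at ha
    rw [ha, sexticResidueSymbol_zero hζ h2 h3]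

/-- `sexticResidueChar hζ 𝔭 h2 h3 a = sexticResidueSymbol 𝔭 a` (unfolding). [cite: IrelandRosen1982, Ch. 14 §2, Prop. 14.2.2] -/
@[simp] theorem sexticResidueChar_apply {𝔭 : HeightOneSpectrum (𝓞 K)}
    (h2 : (2 : 𝓞 K) ∉ 𝔭.asIdeal) (h3 : (3 : 𝓞 K) ∉ 𝔭.asIdeal) (a : 𝓞 K ⧸ 𝔭.asIdeal) :
    sexticResidueChar hζ 𝔭 h2 h3 a = sexticResidueSymbol 𝔭 a :=
  rfl

/-- The sextic residue character has order dividing `6`: `χ_𝔭⁶ = 1`. [cite: IrelandRosen1982, Ch. 14 §2, Prop. 14.2.2] -/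
theorem sexticResidueChar_pow_six {𝔭 : HeightOneSpectrum (𝓞 K)}
    (h2 : (2 : 𝓞 K) ∉ 𝔭.asIdeal) (h3 : (3 : 𝓞 K) ∉ 𝔭.asIdeal) :
    sexticResidueChar hζ 𝔭 h2 h3 ^ 6 = 1 := by
  refine MulChar.ext fun u => ?_
  rw [MulChar.pow_apply_coe, MulChar.one_apply_coe, sexticResidueChar_apply]
  exact (sexticResidueSymbol_spec hζ h2 h3 (Units.ne_zero u)).1

/-- `χ_𝔭²` is the tree's cubic residue character (as multiplicative characters, `𝔭 ∤ 6`). [cite: IrelandRosen1982, Ch. 14 §2, Prop. 14.2.2] -/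
theorem sexticResidueChar_sq {𝔭 : HeightOneSpectrum (𝓞 K)}
    (h2 : (2 : 𝓞 K) ∉ 𝔭.asIdeal) (h3 : (3 : 𝓞 K) ∉ 𝔭.asIdeal) :
    sexticResidueChar hζ 𝔭 h2 h3 ^ 2 = cubicResidueChar (isPrimitiveRoot_sq_three hζ) 𝔭 h3 := by
  refine MulChar.ext fun u => ?_
  rw [MulChar.pow_apply_coe, sexticResidueChar_apply, cubicResidueChar_apply]
  exact sexticResidueSymbol_sq hζ h2 h3 u

end Literature.NumberTheory.GaloisRepresentations
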